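import Summits.CriticalPhenomena.PercolationContinuityZ3.Theorems.Transplant.D4SKPath
import HarnessLib

/-!
# Diamond film `D_4` certificate, V: A COVER BIT IS A SWAP PAIR; the certificate readers; THE NODE CLAUSE OF `ShapedLinkageX 4` FOR ONE COVERED CASE

builds on p205010 (kernel theorem, internal audit signed; external expert review pending) — NOT used in this file.  Lane `prim-bschramm`, seat `prim-bschramm-p2` (gen 42; class C1b;
memo `HOME/bschramm/P2-LATTICES.md` §150); helper file (`--supports stmt-CriticalPhenomena-4575 --as helper`).
«TriFilmSKPlan» + «TriFilmSKCase» for `D_4`: `routing_sound`, **`coverOf_sound`** (a bit of `coverOf` is a swap pair of `VRouteData`), `RowOK`/`CaseOK`, `rdPlans_sound`,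
`checkRow_sound`, **`checkEs_sound`**, `caseOK_of_chunks`, and **`linkage_of_caseOK`**: a covered case with an admissible mask gives, for every centre `z ≡ (c₀, c₁)` and all
node parameters the case dominates (`C.tR = min t_R 4`, blocks `min · 4`, windows `≤ C.·` or `C.· = 5`), the `∃ W` clause of `ShapedLinkageX 4 (DiamondFilm.sqShadow)`.
[cite: DuminilCopinSidoraviciusTassion2016, §2.3 (proof of Fact 2: γ_u, γ_v, γ_w and "(z,v) ≺ (z,w)")]
-/

noncomputable section

namespace Summit.CriticalPhenomena.PercolationContinuityZ3.Theorems.Transplant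

open Literature.Probability.Percolation Literature.Probability.LatticeModels SimpleGraph

namespace DiamondFilm.SK

open Slab111.SK (mem_ne_ends eq_dropLast_append_of_getLast? eq_cons_tail_of_head? of_testBit_cond_not of_testBit_match_option bitOf sdiff lowIdx maskBelow maskOfList endsOK
  orFold rd rdMask testBit_bitOf testBit_sdiff testBit_maskBelow of_testBit_maskBelow testBit_maskBelow_of testBit_maskOfList testBit_maskOfList_eq_false endsOK_sound
  testBit_of_sdiff_beq)

variable {C : Ctx} {z : Site 2}

/-! ## §1 One routing; a cover bit is a swap pair -/

/-- **ONE RE-VALIDATED ROUTING WITH A REACHABLE BRANCH TARGET IS A `VRouteData`.** [cite: DuminilCopinSidoraviciusTassion2016, §2.3 (proof of Fact 2: γ_u, γ_v, γ_w)] -/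
theorem routing_sound (hz : CtrOK C z) {tR sR : ℕ} (htR : C.tR = min tR 4) (hsR : min C.sR 4 = min sR 4)
    (hWv : ∀ i, C.W.testBit i = true → C.validB i = true) {e1 e2 c t o w : ℕ} {A T : List ℕ}
    (hv1 : C.validB e1 = true) (hne : e1 ≠ e2) (hWR2 : C.WR.testBit e2 = true)
    (hc : c = e1 ∨ C.WR.testBit c = true) (ho : C.WR.testBit o = true) (hct : C.adjB c t = true) (hco : C.adjB c o = true)
    (hA : C.pathOK (C.WR ||| bitOf e1 ||| bitOf c) A 0 = true) (hAe : endsOK A e1 c = true)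
    (hT : C.pathOK (sdiff (C.WR ||| bitOf e2) (maskOfList A)) T 0 = true) (hTe : endsOK T t e2 = true)
    (hg : (C.reach (sdiff C.W (maskOfList A ||| maskOfList T)) (bitOf o)).testBit w = true) :
    ∃ r : VRouteData (diamondGraph.induce (diamondFilm 4)) (Wset C z ∩ Ψ4.lift (sqBlkR 4 z tR sR)) (Wset C z) (vtx z e1) (vtx z e2) (vtx z w),
      r.y = vtx z t ∧ r.b = vtx z o := by
  have hWRv : ∀ {i}, C.WR.testBit i = true → C.validB i = true := fun h => hWv _ ((testBit_WR_iff C _).1 h).1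
  have hv2 := hWRv hWR2
  have hvc : C.validB c = true := by rcases hc with rfl | hc; exact hv1; exact hWRv hc
  have hvo := hWRv ho
  obtain ⟨hAch, hAnd, hAmem⟩ := pathOK_sound C _ A 0 hA
  obtain ⟨hTch, hTnd, hTmem⟩ := pathOK_sound C _ T 0 hT
  obtain ⟨hAh, hAl⟩ := endsOK_sound hAe
  obtain ⟨hTh, hTl⟩ := endsOK_sound hTe
  have hAin : ∀ x ∈ A, C.WR.testBit x = true ∨ x = e1 ∨ x = c := by
    intro x hx
    have := (hAmem x hx).1
    simp only [Nat.testBit_lor, testBit_bitOf, Bool.or_eq_true, decide_eq_true_eq] at this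
    rcases this with (h | h) | h
    · exact Or.inl h
    · exact Or.inr (Or.inl h.symm)
    · exact Or.inr (Or.inr h.symm)
  have hTin : ∀ x ∈ T, (C.WR.testBit x = true ∨ x = e2) ∧ x ∉ A := by
    intro x hx
    have := (hTmem x hx).1
    rw [testBit_sdiff, Bool.and_eq_true, Nat.testBit_lor, Bool.or_eq_true, testBit_bitOf, Bool.not_eq_true',
      testBit_maskOfList_eq_false] at this
    simp only [decide_eq_true_eq] at this
    rcases this with ⟨h | h, hnA⟩
    · exact ⟨Or.inl h, hnA⟩
    · exact ⟨Or.inr h.symm, hnA⟩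
  have hAv : ∀ x ∈ A, C.validB x = true := by
    intro x hx; rcases hAin x hx with h | rfl | rfl
    · exact hWRv h
    · exact hv1
    · exact hvc
  have hTv : ∀ x ∈ T, C.validB x = true := by
    intro x hx; rcases (hTin x hx).1 with h | rfl
    · exact hWRv h
    · exact hv2
  set SP := A ++ T with hSPdef
  have hSPv : ∀ x ∈ SP, C.validB x = true := by
    intro x hx; rcases List.mem_append.1 hx with hx | hx; exact hAv x hx; exact hTv x hx
  have hSPch : SP.IsChain (AdjRel C) := by
    rw [hSPdef, List.isChain_append]
    refine ⟨hAch, hTch, fun x hx y hy => ?_⟩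
    rw [hAl, Option.mem_def, Option.some.injEq] at hx
    rw [hTh, Option.mem_def, Option.some.injEq] at hy
    subst hx hy; exact hct
  have hSPnd : SP.Nodup := by
    rw [hSPdef, List.nodup_append]
    exact ⟨hAnd, hTnd, fun x hx y hy hxy => (hTin y hy).2 (hxy ▸ hx)⟩
  have hSPh : SP.head? = some e1 := by rw [hSPdef, List.head?_append, hAh]; rfl
  have hSPl : SP.getLast? = some e2 := by rw [hSPdef, List.getLast?_append, hTl]; rfl
  have hGP := gpath_of_idx' (z := z) hz hSPv hSPch hSPnd hSPh hSPl
  have hint : ∀ x ∈ (SP.map (vtx z)).tail.dropLast, x ∈ Wset C z ∩ Ψ4.lift (sqBlkR 4 z tR sR) := by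
    intro x hx
    obtain ⟨hxm, hx1, hx2⟩ := mem_ne_ends hGP.nodup hGP.head hGP.last hx
    obtain ⟨j, hj, rfl⟩ := List.mem_map.1 hxm
    have hjv := hSPv j hj
    rw [← testBit_WR_iff_mem hz hjv htR hsR]
    rcases List.mem_append.1 hj with hjA | hjT
    · rcases hAin j hjA with h | rfl | rfl
      · exact h
      · exact absurd rfl hx1
      · rcases hc with rfl | h
        · exact absurd rfl hx1
        · exact h
    · rcases (hTin j hjT).1 with h | rfl
      · exact h
      · exact absurd rfl hx2
  have hcy : ∃ l₁ l₂ : List (diamondFilm 4), SP.map (vtx z) = l₁ ++ vtx z c :: vtx z t :: l₂ := by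
    refine ⟨A.dropLast.map (vtx z), T.tail.map (vtx z), ?_⟩
    rw [hSPdef, eq_dropLast_append_of_getLast? hAl, eq_cons_tail_of_head? hTh]
    simp
  have hRv : ∀ i, (sdiff C.W (maskOfList A ||| maskOfList T)).testBit i = true → C.validB i = true := by
    intro i hi
    rw [testBit_sdiff, Bool.and_eq_true] at hi
    exact hWv i hi.1
  obtain ⟨Br, hBr, hBrR⟩ := exists_branch_of_reach (z := z) hz hRv hg
  have hBrW : ∀ x ∈ Br, x ∈ Wset C z := by
    intro x hx
    obtain ⟨j, hjv, hjR, rfl⟩ := hBrR x hx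
    rw [testBit_sdiff, Bool.and_eq_true] at hjR
    exact (vtx_mem_Wset_iff hz hjv).2 hjR.1
  have hoff : ∀ x ∈ Br, x ∉ SP.map (vtx z) := by
    intro x hx hxSP
    obtain ⟨j, hjv, hjR, rfl⟩ := hBrR x hx
    rw [testBit_sdiff, Bool.and_eq_true, Nat.testBit_lor, Bool.not_eq_true', Bool.or_eq_false_iff, testBit_maskOfList_eq_false,
      testBit_maskOfList_eq_false] at hjR
    have hj := (mem_map_vtx_iff hz hSPv hjv).1 hxSP
    rcases List.mem_append.1 hj with h | h
    · exact hjR.2.1 h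
    · exact hjR.2.2 h
  have hcb : (diamondGraph.induce (diamondFilm 4)).Adj (vtx z c) (vtx z o) := adj_vtx hz hvc hvo hco
  have hneV : vtx z e1 ≠ vtx z e2 := fun h => hne (vtx_inj hz hv1 hv2 h)
  exact ⟨VRouteData.ofPaths hGP hneV hint hcy hBr hBrW hcb hoff, VRouteData.ofPaths_y hGP hneV hint hcy hBr hBrW hcb hoff,
    VRouteData.ofPaths_b hGP hneV hint hcy hBr hBrW hcb hoff⟩

/-- **A COVER BIT IS A SWAP PAIR.**  [cite: DuminilCopinSidoraviciusTassion2016, §2.3 (proof of Fact 2: γ_u, γ_v, γ_w and "(z,v) ≺ (z,w)")] -/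
theorem coverOf_sound (hz : CtrOK C z) {tR sR : ℕ} (htR : C.tR = min tR 4) (hsR : min C.sR 4 = min sR 4)
    (hWv : ∀ i, C.W.testBit i = true → C.validB i = true) {e1 e2 w c1 y b c2 av : ℕ}
    (h : (C.coverOf e1 e2 c1 y b c2 av).testBit w = true) :
    ∃ r₁ r₂ : VRouteData (diamondGraph.induce (diamondFilm 4)) (Wset C z ∩ Ψ4.lift (sqBlkR 4 z tR sR)) (Wset C z) (vtx z e1) (vtx z e2) (vtx z w),
      r₁.y = r₂.b ∧ r₁.b = r₂.y := by
  unfold Ctx.coverOf at h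
  try dsimp only at h
  obtain ⟨hst, h⟩ := of_testBit_cond_not h
  simp only [Bool.and_eq_true, Bool.or_eq_true, bne_iff_ne, ne_eq, beq_iff_eq] at hst
  obtain ⟨⟨⟨⟨⟨⟨⟨⟨⟨⟨⟨⟨⟨⟨⟨⟨⟨⟨⟨⟨⟨⟨⟨⟨⟨hne, hyb⟩, hye1⟩, hbe1⟩, hbe2⟩, hc1e2⟩, hc2e2⟩, hye2⟩, hc1⟩, hc2⟩, hyR⟩, hbR⟩, hbW⟩, hc1y⟩, hc1b⟩, hc2y⟩, hc2b⟩,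
    hc1ney⟩, hc1neb⟩, hc2ney⟩, hc2neb⟩, hu1⟩, hu2⟩, hWR1⟩, hWR2⟩, hav⟩ := hst
  have hv1 : C.validB e1 = true := (testBit_univ_iff C e1).1 hu1
  obtain ⟨A, hAeq, h⟩ := of_testBit_match_option h
  try dsimp only at h
  obtain ⟨Y, hYeq, h⟩ := of_testBit_match_option h
  try dsimp only at h
  obtain ⟨hval1, h⟩ := of_testBit_cond_not h
  simp only [Bool.and_eq_true] at hval1
  obtain ⟨⟨⟨hA, hAe⟩, hY⟩, hYe⟩ := hval1
  obtain ⟨A2, hA2eq, h⟩ := of_testBit_match_option h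
  try dsimp only at h
  obtain ⟨B, hBeq, h⟩ := of_testBit_match_option h
  try dsimp only at h
  obtain ⟨hval2, h⟩ := of_testBit_cond_not h
  simp only [Bool.and_eq_true] at hval2
  obtain ⟨⟨⟨hA2, hA2e⟩, hB⟩, hBe⟩ := hval2
  rw [Nat.testBit_land, Bool.and_eq_true] at h
  obtain ⟨hg1, hg2⟩ := h
  have hc1' : c1 = e1 ∨ C.WR.testBit c1 = true := by rcases hc1 with h | h; exact Or.inl h; exact Or.inr h
  have hc2' : c2 = e1 ∨ C.WR.testBit c2 = true := by rcases hc2 with h | h; exact Or.inl h; exact Or.inr h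
  obtain ⟨r₁, hr₁y, hr₁b⟩ := routing_sound (z := z) hz htR hsR hWv hv1 hne hWR2 hc1' hbR hc1y hc1b hA hAe hY hYe hg1
  obtain ⟨r₂, hr₂y, hr₂b⟩ := routing_sound (z := z) hz htR hsR hWv hv1 hne hWR2 hc2' hyR hc2b hc2y hA2 hA2e hB hBe hg2
  exact ⟨r₁, r₂, by rw [hr₁y, hr₂b], by rw [hr₁b, hr₂y]⟩

/-! ## §2 Case coverage and the certificate readers -/

/-- **Row coverage**: every needed bit of every partner of `e₁` has a covering plan. [folklore] -/
def RowOK (C : Ctx) (e1 : ℕ) : Prop :=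
  ∀ e2 ∈ C.esList, e2 ≠ e1 → ∀ w, (C.needMask e1 e2).testBit w = true → ∃ c1 y b c2 av, (C.coverOf e1 e2 c1 y b c2 av).testBit w = true

/-- **Case coverage**: all rows. [folklore] -/
def CaseOK (C : Ctx) : Prop := ∀ e1 ∈ C.esList, RowOK C e1

/-- Soundness of the plan reader. [folklore] -/
theorem rdPlans_sound (D : DiamondFilm.SK.Ctx) (e1 e2 w : ℕ) : ∀ (cnt n acc : ℕ), (D.rdPlans e1 e2 cnt n acc).1.testBit w = true →
    acc.testBit w = true ∨ ∃ c1 y b c2 av, (D.coverOf e1 e2 c1 y b c2 av).testBit w = true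
  | 0, _, _, h => Or.inl h
  | cnt + 1, n, acc, h => by
    simp only [Ctx.rdPlans] at h
    rcases rdPlans_sound D e1 e2 w cnt _ _ h with h | h
    · revert h
      cases (D.coverOf e1 e2 (rd n).1 (rd (rd n).2).1 (rd (rd (rd n).2).2).1 (rd (rd (rd (rd n).2).2).2).1
          (rdMask (rd (rd (rd (rd (rd n).2).2).2).2).1 (rd (rd (rd (rd (rd n).2).2).2).2).2 0).1 == 0) with
      | true => intro h; exact Or.inl h
      | false =>
        intro h
        simp only [cond_false, Nat.testBit_lor, Bool.or_eq_true] at h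
        rcases h with h | h
        · exact Or.inl h
        · exact Or.inr ⟨_, _, _, _, _, h⟩
    · exact Or.inr h

/-- **Soundness of the row checker.** [folklore] -/
theorem checkRow_sound (D : DiamondFilm.SK.Ctx) (e1 : ℕ) : ∀ (es : List ℕ) (n : ℕ), D.checkRow e1 es n = true →
    ∀ e2 ∈ es, e2 ≠ e1 → ∀ w, (D.needMask e1 e2).testBit w = true → ∃ c1 y b c2 av, (D.coverOf e1 e2 c1 y b c2 av).testBit w = true
  | [], _, _ => fun _ h => nomatch h
  | e2 :: rest, n, h => by
    intro x hx hxe w hw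
    simp only [Ctx.checkRow] at h
    by_cases he : e2 = e1
    · have hb : (e2 == e1) = true := by simp [he]
      rw [hb, cond_true] at h
      rcases List.mem_cons.1 hx with rfl | hx
      · exact absurd he hxe
      · exact checkRow_sound D e1 rest n h x hx hxe w hw
    · have hb : (e2 == e1) = false := by simp [he]
      rw [hb, cond_false] at h
      by_cases hn : D.needMask e1 e2 = 0
      · have hb2 : (D.needMask e1 e2 == 0) = true := by simp [hn]
        rw [hb2, cond_true] at h
        rcases List.mem_cons.1 hx with rfl | hx
        · rw [hn, Nat.zero_testBit] at hw; exact absurd hw Bool.false_ne_true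
        · exact checkRow_sound D e1 rest n h x hx hxe w hw
      · have hb2 : (D.needMask e1 e2 == 0) = false := by simp [hn]
        rw [hb2, cond_false] at h
        try dsimp only at h
        generalize hr : D.rdPlans e1 e2 (rd n).1 (rd n).2 0 = r at h
        cases hs : (sdiff (D.needMask e1 e2) r.1 == 0) with
        | false => rw [hs] at h; exact absurd h Bool.false_ne_true
        | true =>
          rw [hs, cond_true] at h
          rcases List.mem_cons.1 hx with rfl | hx
          · have hcov := testBit_of_sdiff_beq hs hw
            rw [← hr] at hcov
            rcases rdPlans_sound D e1 _ w _ _ _ hcov with h0 | hp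
            · rw [Nat.zero_testBit] at h0; exact absurd h0 Bool.false_ne_true
            · exact hp
          · exact checkRow_sound D e1 rest _ h x hx hxe w hw

/-- **SOUNDNESS OF A KERNEL-CHECKED CHUNK**: `C.checkEs es certs = true` gives row coverage for every terminal of the chunk. [folklore] -/
theorem checkEs_sound (D : DiamondFilm.SK.Ctx) : ∀ (es certs : List ℕ), D.checkEs es certs = true → ∀ e1 ∈ es, RowOK D e1
  | [], _, _ => fun _ h => nomatch h
  | e1 :: rest, certs, h => by
    intro x hx
    cases certs with
    | nil => simp [Ctx.checkEs] at h
    | cons n certs' =>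
      simp only [Ctx.checkEs] at h
      cases hrow : D.checkRow e1 D.esList n with
      | false => rw [hrow] at h; exact absurd h Bool.false_ne_true
      | true =>
        rw [hrow, cond_true] at h
        rcases List.mem_cons.1 hx with rfl | hx
        · exact fun e2 he2 hne w hw => checkRow_sound D x D.esList n hrow e2 he2 hne w hw
        · exact checkEs_sound D rest certs' h x hx

/-- **Case coverage from chunks covering the terminal list.** [folklore] -/
theorem caseOK_of_chunks (D : DiamondFilm.SK.Ctx) (chunks : List (List ℕ)) (h : ∀ ch ∈ chunks, ∀ e1 ∈ ch, RowOK D e1)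
    (hcov : (D.esList.all fun e => chunks.any fun ch => ch.elem e) = true) : CaseOK D := by
  intro e1 he1
  rw [List.all_eq_true] at hcov
  have := hcov e1 he1
  rw [List.any_eq_true] at this
  obtain ⟨ch, hch, hel⟩ := this
  exact h ch hch e1 (List.elem_iff.1 hel)

/-! ## §3 The node clause for a covered case -/

/-- **THE NODE CLAUSE OF `ShapedLinkageX 4 (DiamondFilm.sqShadow)` FOR ONE COVERED CASE.**  For a case context `C` with `CaseOK C` and `C.wOK` (the mask inside the cleared block,
containing the forced core), every centre `z ≡ (c₀, c₁) mod 2` and all node parameters the case dominates (`C.tR = min t_R 4`, `min C.tD 4 = min t_D 4`, `min C.sR 4 = min s_R 4`,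
`min C.sD 4 = min s_D 4`, windows `t_D ≤ C.tD ∨ C.tD = 5` etc.): the cleared set `Wset C z` lies in `\overline{sqBlkR 4 z t_D s_D}`, contains every vertex over `sqBall z 1 ∩
sqBlkR 4 z t_D s_D`, and every `TerminalsX`-certified triple has a swap pair of routings. [cite: DuminilCopinSidoraviciusTassion2016, §2.3 (proof of Fact 2: the three disjoint paths in B_R(z))] -/
theorem linkage_of_caseOK (hcase : CaseOK C) (hz : CtrOK C z) {tR tD sR sD : ℕ}
    (htR : C.tR = min tR 4) (htD : min C.tD 4 = min tD 4) (hsR : min C.sR 4 = min sR 4) (hsD : min C.sD 4 = min sD 4)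
    (hwT : tD ≤ C.tD ∨ 5 ≤ C.tD) (hwS : sR ≤ C.sR ∨ 5 ≤ C.sR) (hwD : sD ≤ C.sD ∨ 5 ≤ C.sD) (hW : C.wOK = true) :
    (∀ x ∈ Wset C z, Ψ4.sh x ∈ sqBlkR 4 z tD sD) ∧
      (∀ x, Ψ4.sh x ∈ sqBall z 1 → Ψ4.sh x ∈ sqBlkR 4 z tD sD → x ∈ Wset C z) ∧
        ∀ (E₁ E₂ w' : diamondFilm 4), Ψ4.TerminalsX 4 z tR tD sR sD (Wset C z) E₁ E₂ w' →
          ∃ r₁ r₂ : VRouteData (diamondGraph.induce (diamondFilm 4)) (Wset C z ∩ Ψ4.lift (sqBlkR 4 z tR sR)) (Wset C z) E₁ E₂ w', r₁.y = r₂.b ∧ r₁.b = r₂.y := by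
  have hW' := hW
  simp only [Ctx.wOK, Bool.and_eq_true] at hW'
  obtain ⟨hWall, hWfor⟩ := hW'
  have hWD : ∀ i, C.W.testBit i = true → C.inDB i = true := fun i hi => (of_testBit_maskBelow (testBit_of_sdiff_beq hWall hi)).2
  have hWv : ∀ i, C.W.testBit i = true → C.validB i = true := by
    intro i hi
    have := hWD i hi
    simp only [Ctx.inDB, Ctx.inBlkB, Bool.and_eq_true] at this
    exact this.1.1.1.1.1.1
  refine ⟨fun x hx => ?_, fun x h1 hD => ?_, fun E₁ E₂ w' hT => ?_⟩
  · obtain ⟨i, hv, hWi, rfl⟩ := exists_idx_of_mem_Wset hx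
    rw [Ψ4_sh]
    exact mem_blkR_of_inDB htD hsD (hWD i hWi)
  · rw [Ψ4_sh] at h1 hD
    obtain ⟨i, hv, rfl⟩ := exists_idx hz x (by rw [mem_sqBall_iff_linear] at h1 ⊢; omega)
    obtain ⟨hDi, h1, h2, h3, h4⟩ := core_of_mem hv htD hsD h1 hD
    have hf : (maskBelow (fun i => C.inDB i && decide (4 ≤ dA i) && decide (dA i ≤ 6) && decide (4 ≤ dB i) && decide (dB i ≤ 6)) 288).testBit i = true :=
      testBit_maskBelow_of ((validB_iff C i).1 hv).1 (by simp only [Bool.and_eq_true, decide_eq_true_eq]; exact ⟨⟨⟨⟨hDi, h1⟩, h2⟩, h3⟩, h4⟩)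
    exact (vtx_mem_Wset_iff hz hv).2 (testBit_of_sdiff_beq hWfor hf)
  · obtain ⟨e1, e2, w, hv1, hv2, hvw, rfl, rfl, rfl, -, -, -, he1, he2, hne, hneed⟩ := terminals_sound hz htR hsR hwT hwS hwD hWD hT
    obtain ⟨c1, y, b, c2, av, hcov⟩ := hcase e1 he1 e2 he2 (Ne.symm hne) w hneed
    exact coverOf_sound hz htR hsR hWv hcov

end DiamondFilm.SK

end Summit.CriticalPhenomena.PercolationContinuityZ3.Theorems.Transplant

end
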